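import Summits.BirchSwinnertonDyer.Rank1Residual.X11b.Three.StepLHalves
import HarnessLib

/-!
# X11b @ `p = 3` (team `x11b3`, N8/O2): the HALVES hypothesis CTL₀@3 (`CharTorsionAt₃ W`) is a
# THEOREM at EVERY X11b@3 pair — no (ram), no `3 ∤ ∏ c_ℓ`, no (iv) — so HALVES reads
# `H1 ∧ H2 ∧ H3 ⇒ Three.StepLAt W` CLASS-WIDE with `hctl` DISCHARGED (seat x11b3-p3, CLASS RECORD lane)

HONEST FRAMING (cell `b2b-bsdres`, run/shared/lean/b2b/bsd-rank1-residual/, verbatim in every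
file): the goal of the cell is to DELETE the COMBINATION-SHAPED residual classes of the
Birch–Swinnerton-Dyer formula for ALL analytic-rank `≤ 1` elliptic curves over `ℚ` — "full BSD
formula for every rank `≤ 1` curve in class `C`" assembled STRICTLY from published theorems — so
that the rank-`≤ 1` remainder becomes exactly the CONSTRUCTION-SHAPED classes, which are TYPED
(missing-input `Prop`s), NOT attempted. This is not "finishing BSD". Team `x11b3` = N8/O2 (X11b at
`p = 3`: `3 ‖ N`, `r_an = 1`, `E[3]` irreducible): RESEARCH ROUTES; published theorems only; the
construction-shaped remainder is TYPED, not attempted; census output = EVIDENCE, never a Literature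
fact; nothing booked; no label change; O2 stays OPEN; no route opened. THEOREMS ONLY (no
definition, no named fact, no `sorry`).

## What is kernel-checked here

`Three/CharTorsionOnA1.lean` (x11b3-p2, R7-8) proved CTL₀@3 on the atom A1 = X11b@3 ∧ (ram) ∧
`3 ∤ ∏_ℓ c_ℓ(E)` from the control IDENTITY (`controlOnTreeAt_heegner_odd_of_facts_of_not_dvd`, whose
exactness needs trivial local kernels at `Σ(N⁺)`, hence `3 ∤ c_ℓ`, and (iv) `E(ℚ_3)[3] = 0`), and
recorded "off A1 NOTHING is claimed … the tree has no torsion-ness theorem for `X_ac`". The tree DOES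
have one: sub-cell multr1-p2's gen-18 datum theorem
`X11b.controlUpperOnTreeAt_datum_of_facts` (`X11b/BDPRouteSelmerCardBoundDatum.lean`) proves the
UPPER half of Cas18 Thm. 2.3, `ControlUpperOnTreeAt p κ 𝔭 γ (embAt K p 𝔭) P :=
∃ n, XAc.HasCharValuationAt (E/K) p κ 𝔭 ∅ γ n ∧ n ≤ …`, at EVERY prime `p`, for every globally
minimal `E/ℚ` with `p` multiplicative and `E[p]` irreducible, every imaginary-quadratic Heegner field
`K` of `N_E`, every non-torsion Heegner point, every anticyclotomic `κ` with generator `γ` and every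
degree-one `𝔭 ∋ p` — from Kolyvagin (`kolyvagin`), Poitou–Tate (`poitouTate_sum_localTatePairing_eq_zero`,
Milne ADT I 4.10(b)) and Tate's local Euler characteristic (`localEulerPoincareCharacteristic`, Milne
ADT I 2.8): Greenberg's criterion (`Sel_𝔭(K_∞, E[p^∞])^γ` finite ⟹ `X_ac` torsion with `f_ac(0) ≠ 0`,
`exists_hasCharValuationAt_of_finite_invariants`) fed by the counting snake lemma with the local
kernels BOUNDED by `p^{ord_p c_w}` (Greenberg LNM 1716 Lemma 3.3) — finite always, trivial only on A1.
Its FIRST conjunct is CTL₀'s body verbatim. Hence: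

* §1 **`charTorsionAt₃_of_mult_of_irr`** — `Mult W 3 → Irr W 3 → CharTorsionAt₃ W`, modulo the three
  named facts (all three are ALREADY binders of S0's statement of record `Three.bsdp_of_stepLAt`);
  `charTorsionAt₃_of_classX11b` — at every X11b@3 pair. The binders of `CharTorsionAt₃` not consumed
  (`Surj W 3`, `Odd d_K`, `L(E^{d_K},1) ≠ 0`, `¬ 3 ∣ Dt.c`) are dropped, as in p2's A1 theorem.
* §2 **`stepLAt_of_halves₃_of_mult_of_irr`** / **`stepLAt_of_halves₃_of_classX11b`** — S10 HALVES@3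
  (`Three.stepLAt_of_halves₃`) with `hctl` DISCHARGED at EVERY X11b@3 pair:
  `exists_isNewformOf → BDPExistsAt₃ W → BDPValueAt₃ W → IMCDivAt₃ W → Three.StepLAt W`.
* §3 **`bsdp_of_halves₃_classwide`** — S0's statement of record `Three.bsdp_of_stepLAt` with its OPEN
  input (T1)₃ `∀ W, StepLAt W` REPLACED by the three halves `∀ W, ClassX11b W 3 → Surj W 3 → H1 ∧
  H2 ∧ H3` and NO control binder (CTL₀ is paid for by `hKo`/`hPT`/`hEP`, which the record already carries);
  same twelve published facts, same (T2′)₃ / (T4″)₃ typed binders.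

Effect on the team's records (flag hygiene, NOT count-moving): the HALVES binder of record
"CTL₀ ∧ H1 ∧ H2 ∧ H3 ⇒ `Three.StepLAt W`" loses CTL₀ on the WHOLE class (road (b) split ∧ (ram) off
A1, road (d), the corner), not only on A1; H1 = W2 (BDP-EXISTS@3; from print up to the ONE residual
`Three.HsiehFrameResidualAt₃ W` by S18), H2 = BDP-VALUE@3, H3 = MI-W3 stay TYPED, construction-shaped
inputs with the R-h labels of `Three/StepLHalves.lean`; every theorem below is CONDITIONAL on them and
on the named facts it lists; nothing is booked; O2 / N8 unchanged; X11 ∧ `r = 1` ∧ `p = 3` stays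
CONSTRUCTION-SHAPED (R6.2).

References: [Castella2018] Thm. 2.3 and its proof, §5 (arXiv:1704.06608 pp. 5–6, 12);
[JetchevSkinnerWan2017] Prop. 3.2.1, Thm. 3.3.1 (arXiv:1512.06894 pp. 10–13); [GreenbergLNM1716] §3
Lemma 3.3 (p. 87), p. 90, §4 Lemma 4.2 (p. 102); [MilneADT2006] Ch. I, Thm. 4.10(b), Thm. 2.8;
[Kolyvagin1990] Thm. A; [Skinner2016PacificMC] Thm. C; [Wuthrich2014] Prop. 21; [Miller2011LMS]
Def. 1.1.
-/

noncomputable section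

open scoped Classical

open WeierstrassCurve NumberField IsDedekindDomain Field
  Literature.NumberTheory.EllipticCurves Literature.NumberTheory.EllipticCurves.GreenbergSelmer
  Literature.NumberTheory.EllipticCurves.ModularForms Literature.NumberTheory.EllipticCurves.Rank1Residual
  Literature.NumberTheory.EllipticCurves.Rank1Residual.Typed Literature.NumberTheory.EllipticCurves.Wuthrich2014
  Literature.NumberTheory.GaloisRepresentations Literature.NumberTheory.GaloisCohomology
  Summit.BirchSwinnertonDyer.Rank1Residual.X11b.AcSelmer Summit.BirchSwinnertonDyer.Rank1Residual.X11b.LocBridge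

namespace Summit.BirchSwinnertonDyer.Rank1Residual.X11b.Three

variable {W : WeierstrassCurve ℚ} [W.IsElliptic] [W.IsGloballyMinimal]

/-! ## §1. CTL₀@3 is a theorem at every multiplicative, irreducible pair — in particular on all of X11b@3 -/

/-- **CTL₀@3 HOLDS at every pair with `3` multiplicative and `E[3]` irreducible** — no (ram) prime, no
`3 ∤ ∏_ℓ c_ℓ(E)`, no `E(ℚ_3)[3] = 0` needed —, modulo Kolyvagin, Poitou–Tate (Milne I 4.10(b)) and the
local Euler characteristic (Milne I 2.8): the first conjunct of multr1-p2's datum theorem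
`X11b.controlUpperOnTreeAt_datum_of_facts` (the `≤` half of Cas18 Thm. 2.3 on the constructed `X_ac`,
every prime; Greenberg's criterion + counting snake lemma with the local kernels bounded by
`p^{ord_p c_w}`). CONDITIONAL on the three named facts only; nothing booked; O2 / N8 unchanged.
[cite: Castella2018, Thm. 2.3 and its proof (arXiv:1704.06608 pp. 5–6)]
[cite: GreenbergLNM1716, §3 Lemma 3.3 (p. 87), p. 90, §4 Lemma 4.2 (p. 102)]
[cite: MilneADT2006, Ch. I, Thm. 4.10(b) and Thm. 2.8] [cite: Kolyvagin1990, Thm. A] -/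
theorem charTorsionAt₃_of_mult_of_irr
    (hKo : ∀ (N : ℕ) [NeZero N] (W : WeierstrassCurve ℚ) (K : Type) [Field K] [NumberField K],
      kolyvagin N W K)
    (hPT : ∀ (K : Type) [Field K] [NumberField K], poitouTate_sum_localTatePairing_eq_zero K)
    (hEP : ∀ (K : Type) [Field K] [NumberField K] (v : HeightOneSpectrum (𝓞 K)),
      localEulerPoincareCharacteristic (v.adicCompletion K))
    (hmult : Mult W 3) (hirr : Irr W 3) : CharTorsionAt₃ W := by
  intro N _ K _ _ Dt H ι P _ _ hN hK _ hHN _ hP _ hPinf κ hκ γ _ 𝔭 h𝔭 he hf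
  obtain ⟨n, hn, -⟩ := controlUpperOnTreeAt_datum_of_facts hKo hPT hEP Dt H ι hmult hirr hN hK hHN
    hP hPinf hκ γ 𝔭 h𝔭 he hf
  exact ⟨n, hn⟩

/-- **CTL₀@3 HOLDS at EVERY X11b@3 pair** (`ClassX11b W 3`: `r_an = 1`, `3 ≠ 2`, `3` multiplicative,
`E[3]` irreducible) — all of road (a), road (b) (split ∧ (ram), on AND off A1), road (d) and the
(T4″) corner —, modulo the three named facts. CONDITIONAL; nothing booked; O2 / N8 unchanged.
[cite: Castella2018, Thm. 2.3 (arXiv:1704.06608 p. 5)] [cite: GreenbergLNM1716, §3 Lemma 3.3 (p. 87)]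
[cite: MilneADT2006, Ch. I, Thm. 4.10(b) and Thm. 2.8] [cite: Kolyvagin1990, Thm. A] -/
theorem charTorsionAt₃_of_classX11b
    (hKo : ∀ (N : ℕ) [NeZero N] (W : WeierstrassCurve ℚ) (K : Type) [Field K] [NumberField K],
      kolyvagin N W K)
    (hPT : ∀ (K : Type) [Field K] [NumberField K], poitouTate_sum_localTatePairing_eq_zero K)
    (hEP : ∀ (K : Type) [Field K] [NumberField K] (v : HeightOneSpectrum (𝓞 K)),
      localEulerPoincareCharacteristic (v.adicCompletion K))
    (hX : ClassX11b W 3) : CharTorsionAt₃ W :=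
  charTorsionAt₃_of_mult_of_irr hKo hPT hEP hX.2.2.1 hX.2.2.2

/-! ## §2. HALVES with `hctl` discharged, class-wide -/

/-- **S10 HALVES@3 with `hctl` DISCHARGED at every multiplicative, irreducible pair**:
`exists_isNewformOf ∧ H1 ∧ H2 ∧ H3 ⟹ Three.StepLAt W` — `Three.stepLAt_of_halves₃` with its hypothesis
`CharTorsionAt₃ W` supplied by `charTorsionAt₃_of_mult_of_irr` (Kolyvagin + Poitou–Tate + local Euler
characteristic). H1 = BDP-EXISTS@3 (W2), H2 = BDP-VALUE@3, H3 = MI-W3 stay TYPED hypotheses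
(construction-shaped, labels in `Three/StepLHalves.lean`); nothing asserted, nothing booked; O2 OPEN.
[cite: Castella2018, Thm. 2.3 (p. 5), §5 (p. 12) (arXiv:1704.06608; assembly shape, inputs typed)]
[cite: GreenbergLNM1716, §3 Lemma 3.3 (p. 87)] -/
theorem stepLAt_of_halves₃_of_mult_of_irr (hnf : exists_isNewformOf)
    (hKo : ∀ (N : ℕ) [NeZero N] (W : WeierstrassCurve ℚ) (K : Type) [Field K] [NumberField K],
      kolyvagin N W K)
    (hPT : ∀ (K : Type) [Field K] [NumberField K], poitouTate_sum_localTatePairing_eq_zero K)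
    (hEP : ∀ (K : Type) [Field K] [NumberField K] (v : HeightOneSpectrum (𝓞 K)),
      localEulerPoincareCharacteristic (v.adicCompletion K))
    (hmult : Mult W 3) (hirr : Irr W 3)
    (h1 : BDPExistsAt₃ W) (h2 : BDPValueAt₃ W) (h3 : IMCDivAt₃ W) : StepLAt W :=
  stepLAt_of_halves₃ hnf (charTorsionAt₃_of_mult_of_irr hKo hPT hEP hmult hirr) h1 h2 h3

/-- **S10 HALVES@3 with `hctl` DISCHARGED at EVERY X11b@3 pair**: `exists_isNewformOf ∧ H1 ∧ H2 ∧ H3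
⟹ Three.StepLAt W`. CONDITIONAL on the three named facts and the three typed halves; nothing
booked; O2 OPEN. [cite: Castella2018, Thm. 2.3 (p. 5), §5 (p. 12) (arXiv:1704.06608; assembly shape, inputs typed)]
[cite: GreenbergLNM1716, §3 Lemma 3.3 (p. 87)] -/
theorem stepLAt_of_halves₃_of_classX11b (hnf : exists_isNewformOf)
    (hKo : ∀ (N : ℕ) [NeZero N] (W : WeierstrassCurve ℚ) (K : Type) [Field K] [NumberField K],
      kolyvagin N W K)
    (hPT : ∀ (K : Type) [Field K] [NumberField K], poitouTate_sum_localTatePairing_eq_zero K)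
    (hEP : ∀ (K : Type) [Field K] [NumberField K] (v : HeightOneSpectrum (𝓞 K)),
      localEulerPoincareCharacteristic (v.adicCompletion K))
    (hX : ClassX11b W 3) (h1 : BDPExistsAt₃ W) (h2 : BDPValueAt₃ W) (h3 : IMCDivAt₃ W) :
    StepLAt W :=
  stepLAt_of_halves₃ hnf (charTorsionAt₃_of_classX11b hKo hPT hEP hX) h1 h2 h3

/-! ## §3. S0's statement of record with (T1)₃ replaced by the three halves — no control binder -/

/-- **`∀ E, (E,3) ∈ X11b → BSD(E,3)` from the TWELVE published named facts of S0's statement of record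
`Three.bsdp_of_stepLAt` + the typed inputs, with the OPEN input (T1)₃ `∀ W, StepLAt W` REPLACED by
the three HALVES H1 = BDP-EXISTS@3, H2 = BDP-VALUE@3, H3 = MI-W3 at every X11b@3 pair with
`ρ̄_{E,3}` onto (the only pairs at which the open input is consumed), and NO control binder** (CTL₀
is a theorem from `hKo`, `hPT`, `hEP`, which the record already carries); (T2′)₃ (Euler-system half
off the atom (ram) ∧ `3 ∤ ∏c`) and (T4″)₃ (the `¬Surj` corner) unchanged. CONDITIONAL on every
listed binder; nothing booked; RESIDUAL-MAP §I O2 unchanged.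
[cite: Castella2018, Thm. 2.3 (p. 5), Thm. 3.2 (p. 9), §5 (p. 12)] [cite: Skinner2016PacificMC, Thm. C (§1) and footnote 1]
[cite: Wuthrich2014, Prop. 21 (p. 400)] [cite: GreenbergLNM1716, §3 Lemma 3.3 (p. 87)] [cite: Miller2011LMS, Def. 1.1] -/
theorem bsdp_of_halves₃_classwide
    (hGZ : ∀ (N : ℕ) [NeZero N] (W : WeierstrassCurve ℚ) (K : Type) [Field K] [NumberField K],
      gross_zagier N W K)
    (hKo : ∀ (N : ℕ) [NeZero N] (W : WeierstrassCurve ℚ) (K : Type) [Field K] [NumberField K],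
      kolyvagin N W K)
    (hB : ∀ (N : ℕ) [NeZero N] (W : WeierstrassCurve ℚ) (K : Type) [Field K] [NumberField K],
      Kolyvagin1990_padicValNat_card_sha_le N W K)
    (hSk : Skinner2016.thmC_padicValRat_bsd_rank_zero) (hWu : sha_dvd_analyticSha)
    (hGZK : rank_eq_analyticRank_of_analyticRank_le_one) (hmod : hasEntireLFunction_rat)
    (hnf : exists_isNewformOf) (hHL : HoffsteinLuo1997_exists_twist_L_one_ne_zero)
    (hMaz : mazur_not_dvd_maninConstant_of_odd)
    (hPT : ∀ (K : Type) [Field K] [NumberField K], poitouTate_sum_localTatePairing_eq_zero K)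
    (hEP : ∀ (K : Type) [Field K] [NumberField K] (v : HeightOneSpectrum (𝓞 K)),
      localEulerPoincareCharacteristic (v.adicCompletion K))
    -- H1 ∧ H2 ∧ H3 at every X11b@3 pair with `ρ̄_{E,3}` onto — TYPED, construction-shaped, no source
    (hH : ∀ (W : WeierstrassCurve ℚ) [W.IsElliptic] [W.IsGloballyMinimal],
      ClassX11b W 3 → Surj W 3 → BDPExistsAt₃ W ∧ BDPValueAt₃ W ∧ IMCDivAt₃ W)
    -- (T2′)₃ the Euler-system half off the unconditional atom (ram) ∧ `3 ∤ ∏ c_ℓ`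
    (hU : ∀ (W : WeierstrassCurve ℚ) [W.IsElliptic] [W.IsGloballyMinimal],
      ClassX11b W 3 → Surj W 3 → ¬ (Ram W 3 ∧ ¬ 3 ∣ W.tamagawaProduct) →
        Typed.MissingUpperBoundAt W 3)
    -- (T4″)₃ the non-surjective corner `3 ∣ ord₃ Δ_min`, no (ram) prime
    (hC : ∀ (W : WeierstrassCurve ℚ) [W.IsElliptic] [W.IsGloballyMinimal],
      ClassX11b W 3 → ¬ Surj W 3 → 3 ∣ padicValInt 3 W.minimalDiscriminantInt → ¬ Ram W 3 →
        Typed.MissingPPartAt W 3)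
    (W : WeierstrassCurve ℚ) [W.IsElliptic] [W.IsGloballyMinimal] (hX : ClassX11b W 3) :
    BSDp W 3 := by
  refine P2.bsdp_three_of_onTree hGZ hKo hB hSk hWu hGZK hmod hnf hHL hMaz hPT hEP ?_ hU hC W hX
  intro W _ _ N _ K _ _ Dt H ι P hX' hs hN hK hodd hpd hμ hHN hLt hP hc hPinf κ hκ γ _ 𝔭 h𝔭 he hf
  obtain ⟨h1, h2, h3⟩ := hH W hX' hs
  exact p2OpenInputOnTreeOddAt_of_stepLAt
    (stepLAt_of_halves₃_of_classX11b hnf hKo hPT hEP hX' h1 h2 h3)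
    N K Dt H ι P hX' hs hN hK hodd hpd hμ hHN hLt hP hc hPinf κ hκ γ 𝔭 h𝔭 he hf

end Summit.BirchSwinnertonDyer.Rank1Residual.X11b.Three

end
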